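import Literature.IUT.HodgeTheaters.PiAvatarModelCuspLabels
import Literature.IUT.HodgeTheaters.PiAvatarBinding
import HarnessLib

/-!
# KIT-INSTANCE-SPEC P5-binding, LABEL slots at the genuine `𝒟^{⊚±}`: `GLab gModel := Cusp(X̲_K)`, its `𝔽_l^±`-torsor,
# the chart based at `ε⁰` (`gChart₀`), and the action of `Π_{C̲_K}` on it (defs — post-freeze additive D13, not a cone member)

S. Mochizuki, *Inter-universal Teichmüller theory I*, kurims manuscript (May 2020), Def 6.1 (iii) p. 156, (v) p. 158, (vi) p. 159
([IUTchI] Def 6.1 (v) p.158) [claim: Mochizuki2012, status: disputed] (D-0012 claim key, series status DISPUTED — definitions over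
abc-iut-L5-t2's REAL `InitialThetaData` and abc-iut-L5-t1's `CuspGalois` (p424023); nothing of the series is asserted, no side is
taken on [IUTchIII] Cor. 3.12).

The instance glue of `PiAvatarModelCuspLabels` (K-level `PuncturedEllipticData`) over `D : InitialThetaData`, `CG : D.geom.pe.CuspGalois`:
`pe_not_PiCbar_le_PiX` (the deck involution exists: `[Π_C̲ : Π_X̲] = 2`), `InitialThetaData.gLabTModel : FlPMTorsor l Cusp(X̲_K)`
(kit slot `gLabT gModel`), `gLabPMModel` (the `𝔽_l^±`-GROUP structure determined by `ε⁰`, Def 6.1 (v)), `gChart₀Model`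
(kit slot `gChart₀`, **based at `ε⁰`** — t13's (K1); `gChart₀Model_ε0`, `gChart₀Model_mem_charts`), and for `c ∈ Π_{C̲_K} = D.PiCund`
(embedded) the label bijection `gLabAutOfPiCund c := CG.act c′` with `embK c′ = c` (t13's (K2): `gLabAutOfPiCund_embK`), read in the
chart: `gChart₀Model_gLabAut_of_not_mem_PiXund` — an element of `Π_{C̲_K} ∖ Π_{X̲_K}` (the `±` involution of `𝒟^{⊚±} → 𝒟^⊚`,
`PiAvatarGlobalInvolution`) acts on the labels by `z ↦ −z`, i.e. IS `(0,−1) ∈ 𝔽_l^{⋊±}` in the chart based at `ε⁰` — the (I2)(ii)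
input of the β-instance.  The extension of the label action to ALL of `Aut(𝒟^{⊚±}) = N(Π_{X̲_K})/Π_{X̲_K}` waits on GAP row G-L5t4g3-3
(F-level cusp action).  No instance/notation declared; typed ≠ proved elsewhere.
-/

noncomputable section

namespace Literature.IUT.HodgeTheaters

open CategoryTheory

universe u v w

section GlobalCuspLabels

variable {F : Type u} {K : Type v} {Fbar : Type w} [Field F] [NumberField F] [Field K] [NumberField K]
  [Algebra F K] [Field Fbar] [Algebra F Fbar] [Algebra K Fbar]
  {E : WeierstrassCurve F} [E.IsElliptic] {l : ℕ} {Pb : BadPlacePredicates K}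
  (D : InitialThetaData F K Fbar E l Pb) (CG : D.geom.pe.CuspGalois)

namespace InitialThetaData

/-- At the genuine initial Θ-data the deck involution exists: `Π_C̲ ≰ Π_X` (else `Π_X̲ = Π_X ∩ Π_C̲ = Π_C̲`, contradicting
`[Π_C̲ : Π_X̲] = 2`, t2's `ThetaGeometry.PiXbar_relIndex_PiCbar`). ([IUTchI] Def 3.1 (d) p.62) [claim: Mochizuki2012, status: disputed] -/
theorem pe_not_PiCbar_le_PiX : ¬ D.geom.pe.PiCbar ≤ D.geom.pe.PiX := by
  intro h
  have hXbar : D.geom.pe.PiXbar = D.geom.pe.PiCbar :=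
    le_antisymm D.geom.pe.piXbar_le_piCbar (le_inf h le_rfl)
  have h2 := D.geom.PiXbar_relIndex_PiCbar
  rw [hXbar, Subgroup.relIndex_self] at h2
  exact absurd h2 (by norm_num)

/-! ### Preimages of elements of `Π_{C̲_K}` under `embK` -/

/-- A preimage under `embK` of an element of `Π_{C̲_K} = embK(Π_C̲)`. ([IUTchI] Def 3.1 (d) p.62) [claim: Mochizuki2012, status: disputed] -/
def preimOfPiCund (c : D.PiC) (hc : c ∈ D.PiCund) : D.geom.pe.PiC := (Subgroup.mem_map.mp hc).choose

/-- The preimage lies in `Π_C̲`. ([IUTchI] Def 3.1 (d) p.62) [claim: Mochizuki2012, status: disputed] -/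
theorem preimOfPiCund_mem (c : D.PiC) (hc : c ∈ D.PiCund) : D.preimOfPiCund c hc ∈ D.geom.pe.PiCbar :=
  (Subgroup.mem_map.mp hc).choose_spec.1

/-- `embK (preimage) = c`. ([IUTchI] Def 3.1 (d) p.62) [claim: Mochizuki2012, status: disputed] -/
theorem embK_preimOfPiCund (c : D.PiC) (hc : c ∈ D.PiCund) : D.geom.embK (D.preimOfPiCund c hc) = c :=
  (Subgroup.mem_map.mp hc).choose_spec.2

/-- The preimage of `embK c′` is `c′` (`embK` injective). ([IUTchI] Def 3.1 (d) p.62) [claim: Mochizuki2012, status: disputed] -/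
theorem preimOfPiCund_embK (c' : D.geom.pe.PiC) (hc' : c' ∈ D.geom.pe.PiCbar) :
    D.preimOfPiCund (D.geom.embK c') (Subgroup.mem_map_of_mem _ hc') = c' :=
  D.geom.embK_injective (D.embK_preimOfPiCund _ _)

/-- If `c ∈ Π_{C̲_K} ∖ Π_{X̲_K}` then its preimage is in `Π_C̲ ∖ Π_X` (`Π_X̲ = Π_X ∩ Π_C̲`).
([IUTchI] Def 3.1 (d) p.62) [claim: Mochizuki2012, status: disputed] -/
theorem preimOfPiCund_not_mem_PiX (c : D.PiC) (hc : c ∈ D.PiCund) (hcX : c ∉ D.PiXund) :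
    D.preimOfPiCund c hc ∉ D.geom.pe.PiX := by
  intro hX
  apply hcX
  rw [← D.embK_preimOfPiCund c hc]
  exact Subgroup.mem_map_of_mem _ (Subgroup.mem_inf.mpr ⟨hX, D.preimOfPiCund_mem c hc⟩)

/-! ### The action of `Π_{C̲_K}` (embedded in `Π_{C_F}`) on the labels -/

/-- **(K2)** the label bijection of `GLab gModel = Cusp(X̲_K)` induced by `c ∈ Π_{C̲_K}`: t1's `CG.act` at the `embK`-preimage.
([IUTchI] Def 6.1 (v) p.158) [claim: Mochizuki2012, status: disputed] -/
def gLabAutOfPiCund (c : D.PiC) (hc : c ∈ D.PiCund) : Equiv.Perm D.geom.pe.Cusp := CG.act (D.preimOfPiCund c hc)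

/-- **(K2), literally**: `gLabAutOfPiCund (embK c′) = CG.act c′`. ([IUTchI] Def 6.1 (v) p.158) [claim: Mochizuki2012, status: disputed] -/
theorem gLabAutOfPiCund_embK (c' : D.geom.pe.PiC) (hc' : c' ∈ D.geom.pe.PiCbar) :
    D.gLabAutOfPiCund CG (D.geom.embK c') (Subgroup.mem_map_of_mem _ hc') = CG.act c' := by
  rw [gLabAutOfPiCund, D.preimOfPiCund_embK c' hc']

/-- Elements of `Π_{X̲_K}` act trivially on the labels (so the action factors through `Π_{C̲_K}/Π_{X̲_K} = Gal(X̲_K/C̲_K)`).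
([IUTchI] Def 6.1 (v) p.158) [claim: Mochizuki2012, status: disputed] -/
theorem gLabAutOfPiCund_eq_one_of_mem_PiXund (c : D.PiC) (hc : c ∈ D.PiCund) (hcX : c ∈ D.PiXund) :
    D.gLabAutOfPiCund CG c hc = 1 := by
  apply CG.act_eq_one_of_mem_PiXbar
  obtain ⟨x, hx, hxc⟩ := Subgroup.mem_map.mp hcX
  have : D.preimOfPiCund c hc = x := D.geom.embK_injective ((D.embK_preimOfPiCund c hc).trans hxc.symm)
  rw [this]
  exact hx

/-- Every `c ∈ Π_{C̲_K}` fixes the zero label `ε⁰` (t1's `act_ε0`). ([IUTchI] Def 6.1 (v) p.158) [claim: Mochizuki2012, status: disputed] -/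
theorem gLabAutOfPiCund_ε0 (c : D.PiC) (hc : c ∈ D.PiCund) : D.gLabAutOfPiCund CG c hc D.geom.pe.ε0 = D.geom.pe.ε0 :=
  CG.act_ε0 _ (D.preimOfPiCund_mem c hc)

/-- The label bijection depends only on the induced AUTOMORPHISM of `𝒟^{⊚±}`: if `c, c′ ∈ Π_{C̲_K}` induce the same
`xΠ_{X̲_K} ↦ xcΠ_{X̲_K}` (i.e. `c⁻¹c′ ∈ Π_{X̲_K}`, t4 `OrbitCat.autOfNormalizer_eq_iff`) then they act identically on the labels — so
`gLabAutOfPiCund` IS a label map `gLabMap` on the subgroup `Π_{C̲_K}/Π_{X̲_K} = Gal(X̲_K/C̲_K) ≤ Aut(𝒟^{⊚±})`.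
([IUTchI] Def 6.1 (v) p.158) [claim: Mochizuki2012, status: disputed] -/
theorem gLabAutOfPiCund_eq_of_autOfNormalizer_eq {c c' : D.PiC} (hc : c ∈ D.PiCund) (hc' : c' ∈ D.PiCund)
    {hn : c ∈ Subgroup.normalizer ((D.PiXund : Subgroup D.PiC) : Set D.PiC)}
    {hn' : c' ∈ Subgroup.normalizer ((D.PiXund : Subgroup D.PiC) : Set D.PiC)}
    (h : OrbitCat.autOfNormalizer c hn = OrbitCat.autOfNormalizer c' hn') :
    D.gLabAutOfPiCund CG c hc = D.gLabAutOfPiCund CG c' hc' := by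
  rw [OrbitCat.autOfNormalizer_eq_iff] at h
  -- `c⁻¹ c′ ∈ Π_{X̲_K} = embK(Π_X̲)`: pull back along the injective `embK`
  obtain ⟨x, hx, hxe⟩ := Subgroup.mem_map.mp h
  have hpre : D.preimOfPiCund c' hc' = D.preimOfPiCund c hc * x := by
    apply D.geom.embK_injective
    rw [map_mul, D.embK_preimOfPiCund, D.embK_preimOfPiCund, hxe, mul_inv_cancel_left]
  rw [gLabAutOfPiCund, gLabAutOfPiCund, hpre, map_mul, CG.act_eq_one_of_mem_PiXbar hx, mul_one]

variable [Fact l.Prime]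

/-- **Kit slot `gLabT gModel`**: the `𝔽_l^±`-TORSOR of cusps of `X̲_K` ([IUTchI] Def 6.1 (iii)/(vi): `LabCusp^±(𝒟^{⊚±})`).
([IUTchI] Def 6.1 (v) p.158) [claim: Mochizuki2012, status: disputed] -/
def gLabTModel : FlPMTorsor l D.geom.pe.Cusp := CG.labT D.geom.PiXbar_relIndex

/-- The `𝔽_l^±`-GROUP structure on the cusps of `X̲_K` determined by the zero cusp `ε⁰` (Def 6.1 (v) «the cusp `ε̲` determines a
natural `𝔽_l^±`-group structure»). ([IUTchI] Def 6.1 (v) p.158) [claim: Mochizuki2012, status: disputed] -/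
def gLabPMModel : FlPMGroup l D.geom.pe.Cusp := CG.labPM D.geom.PiXbar_relIndex

/-- The torsor is the one underlying the group structure. ([IUTchI] Def 6.1 (v) p.158) [claim: Mochizuki2012, status: disputed] -/
theorem gLabTModel_eq : D.gLabTModel CG = (D.gLabPMModel CG).toTorsor := rfl

/-- **Kit slot `gChart₀`** — the fixed chart `Cusp(X̲_K) ≃ 𝔽_l`, BASED AT THE ZERO CUSP (t13's (K1)).
([IUTchI] Def 6.1 (iii) p.156) [claim: Mochizuki2012, status: disputed] -/
def gChart₀Model : D.geom.pe.Cusp ≃ ZMod l := CG.labChart D.geom.PiXbar_relIndex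

/-- **(K1)** `gChart₀ ε⁰ = 0`. ([IUTchI] Def 6.1 (iii) p.156) [claim: Mochizuki2012, status: disputed] -/
theorem gChart₀Model_ε0 : D.gChart₀Model CG D.geom.pe.ε0 = 0 := CG.labChart_ε0 _

/-- `gChart₀ ε′ = 1`. ([IUTchI] Def 6.1 (v) p.158) [claim: Mochizuki2012, status: disputed] -/
theorem gChart₀Model_ε1 : D.gChart₀Model CG D.geom.pe.ε1 = 1 := CG.labChart_ε1 _

/-- `gChart₀` is a chart of the torsor `gLabT gModel` (kit law `gChart₀_mem`). ([IUTchI] Def 6.1 (iii) p.156) [claim: Mochizuki2012, status: disputed] -/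
theorem gChart₀Model_mem_charts : D.gChart₀Model CG ∈ (D.gLabTModel CG).charts := CG.labChart_mem_labT_charts _

/-- `gChart₀` is a chart of the `𝔽_l^±`-group structure. ([IUTchI] Def 6.1 (v) p.158) [claim: Mochizuki2012, status: disputed] -/
theorem gChart₀Model_mem_gLabPMModel_charts : D.gChart₀Model CG ∈ (D.gLabPMModel CG).charts := CG.labChart_mem_charts _

/-! ### The `±` involution in the chart -/

/-- **The `±` involution reads `(0,−1)` in the chart based at `ε⁰`**: for `c ∈ Π_{C̲_K} ∖ Π_{X̲_K}`,
`gChart₀ (c·x) = − gChart₀ x` ((I2)(ii) input of the β-instance; [IUTchI] Def 6.1 (v) «`ι̲` fixes `ε̲⁰` and switches `ε̲′, ε̲″`»,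
Ex 6.3 (i)). ([IUTchI] Def 6.1 (v) p.158) [claim: Mochizuki2012, status: disputed] -/
theorem gChart₀Model_gLabAut_of_not_mem_PiXund (c : D.PiC) (hc : c ∈ D.PiCund) (hcX : c ∉ D.PiXund) (x : D.geom.pe.Cusp) :
    D.gChart₀Model CG (D.gLabAutOfPiCund CG c hc x) = - D.gChart₀Model CG x :=
  CG.labChart_act_of_not_mem_PiX _ (D.preimOfPiCund_mem c hc) (D.preimOfPiCund_not_mem_PiX c hc hcX) x

/-- In coordinates: `gChart₀⁻¹ ≫ (c·) ≫ gChart₀ = signPerm (−1)` for `c ∈ Π_{C̲_K} ∖ Π_{X̲_K}`.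
([IUTchI] Def 6.1 (v) p.158) [claim: Mochizuki2012, status: disputed] -/
theorem gChart₀Model_conj_gLabAut_of_not_mem_PiXund (c : D.PiC) (hc : c ∈ D.PiCund) (hcX : c ∉ D.PiXund) :
    (D.gChart₀Model CG).symm.trans ((D.gLabAutOfPiCund CG c hc).trans (D.gChart₀Model CG)) = signPerm l (-1) :=
  CG.labChart_conj_act_of_not_mem_PiX _ (D.preimOfPiCund_mem c hc) (D.preimOfPiCund_not_mem_PiX c hc hcX)

/-- The `±` involution is an automorphism of the `𝔽_l^±`-group of labels (`(c·) ≫ gChart₀` is a chart).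
([IUTchI] Def 6.1 (v) p.158) [claim: Mochizuki2012, status: disputed] -/
theorem gLabAut_trans_gChart₀Model_mem_charts (c : D.PiC) (hc : c ∈ D.PiCund) (hcX : c ∉ D.PiXund) :
    (D.gLabAutOfPiCund CG c hc).trans (D.gChart₀Model CG) ∈ (D.gLabPMModel CG).charts :=
  CG.act_trans_labChart_mem_charts_of_not_mem_PiX _ (D.preimOfPiCund_mem c hc) (D.preimOfPiCund_not_mem_PiX c hc hcX)

end InitialThetaData

end GlobalCuspLabels

end Literature.IUT.HodgeTheaters
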